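import Summits.ABC.IUTFork.Repair.RHLinearReachLawGenuine
import Summits.ABC.IUTFork.Repair.CandInternal2Real
import Summits.ABC.IUTFork.Repair.RHLabelCutJ3K2
import Literature.IUT.LogVolume.TensorPacketUnramifiedShell
import Literature.IUT.LogVolume.PadicSubfields
import HarnessLib

/-!
# R-H ROUND 1 (D-0107), ROW 20 «linear-reach-law» — TESTER's k2 KERNEL LEMMAS (abc-iut-rh-tst-7, gen 2): the candidate
# `RH.LinearReachLaw.HStarLinearReachLaw` is FALSE at EVERY absolutely unramified odd place (c_w = B_w = 1, D_w = 0), at every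
# label `j ≥ 1` and depth `m ≥ 0` — and that stratum carries NO bad place of the genuine `K`-level datum (scope, not a kill)

PROOF-ONLY file (0 definitions, 0 `Prop` facts) of the abc-iut cell, rung LADDER-ABC:A2.RESCUE.H, R-H tester seat abc-iut-rh-tst-7
(gen 2; pair n = 7 → row 20 of `plan/rescue/R-H/RH-CANDIDATES.tsv`; author of the candidate abc-iut-lens-control-1, decl filed for the
tree by abc-iut-rh-typ-1 as `Repair/RHLinearReachLaw.lean`; lead abc-iut-rh-lead g0; referee abc-iut-rh-ref-2). TAKES NO SIDE on
[IUTchIII] Cor. 3.12 or on any author (Mochizuki / Scholze–Stix / Joshi / Dupuy–Hilado); candidates are hypotheses; typed ≠ proved;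
nothing here asserts that abc is proved or refuted.

QUESTION (director-abc 15:32:46Z, test k2): does H⋆₂₀ survive the unramified-odd refutation family that killed RP-I06⋆ as typed
(`Repair.CandInternal2Real.not_mem_jsq_smul_logShell_of_unramified` p432650, `Repair.EvalHonestCeiling.i06_false_of_honest`,
`Cor312Vol.LicenceSharpDegreeOne.not_pilotKummerCompatHull_settingPrVolSharp_rat_of_qPinned`, C-cert-2's deep-unramified NEG)?

ANSWER (kernel, this file).
* §1–§2 PLACE LEVEL. At an absolutely unramified odd place (`absRamificationIdx p K = 1`, `2 < p`) the unit-log lattice is the ball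
  `log_p(𝒪_K^×) = p·𝒪_K` ([IUTchIV] Prop. 1.2 (i); `Literature.IUT.LogVolume.mem_logUnits_iff_norm_le_of_unramified` — the SAME set
  identity that makes the real log-shell `ℐ_K = 𝒪_K` in p432650), so for a norm uniformizer `‖ϖ‖ = p⁻¹` the candidate's two integers are
  forced: inner conductor `c_w = 1` (`isInnerConductor_one`), outer order `B_w = 1` (`isOuterOrder_one`), inflation `D_w = 0`, and the
  linear reach law reads `(j² − 1)·m + 1 ≤ 0` — FALSE at every label `j ≥ 1`, every depth `m ≥ 0`
  (`not_hStarLinearReachLaw_of_unramified`, `not_hStarLinearReachLaw_padic` at `K_w = ℚ_p`, `ϖ = p`); the exact companion `HReachCell`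
  is FALSE at `j ≥ 2`, `m ≥ 1` (`not_hReachCell_of_unramified`) and TRUE at `j = 1` (`reachCell_one_one_one_label_one`) — I06⋆'s own sign
  pattern on the stratum. JUNK BINDING: at a unit of norm `1` the inner conductor is uninhabited and the decl holds VACUOUSLY
  (`hStarLinearReachLaw_of_norm_eq_one`) — the datum-level typing must pin `ϖ` to a uniformizer (abc-iut-rh-typ-1's `HStarGenuine` does).
* §3 DATUM LEVEL (abc-iut-rh-typ-7's deciding declaration `RH.LinearReachLaw.CellAt` / `HStar`, p464190, `ϖ` pinned by
  `IsUniformizer`): `not_cellAt_of_unramified_odd` (every label, `e(x|p) = 1`, `p` odd, `ord_x(q) ≥ 0`) and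
  `not_hStar_of_unramified_odd_badPlace` (¬ `HStar X` at every pilot datum with an absolutely unramified odd bad place) — via typ-7's
  own column certificate `not_cellAt_of_not_col` at the turning point `a₀ = 0`.
* §4 SCOPE (v1's §3). READING for a SUFFICIENT-side candidate («H⋆₂₀ ⟹ S_H»): FALSE-on-the-stratum is the REQUIRED behaviour where `S_H` itself is
  refuted (R-W row S-RAT, C-cert-2), i.e. consistent-NEG, not a kill; and at print's own `K`-level pilot datum the stratum is EMPTY —
  every bad place has `e ≥ l ≥ 5` (`Cor312Prov.l_le_absRamificationIdx_kOf_pilotDataOfK`,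
  `RHLabelCutJ3K2.absRamificationIdx_ne_one_pilotDataOfK`, restated here as `no_unramified_instance_at_genuine_badPlace` / `ramificationIdx_ne_one_at_genuine_badPlace`), so no member
  of the family has an instance on the genuine reading. HONEST SCOPE: a k2 finding for the unramified-odd family ONLY; it says nothing in
  favour of row 20 (k1 of record: 59.6 % / 59.2 % ≪ 95 %, KILL(k1); slice WINDOW-LOCATOR(HEX k ≤ 5), tester line 18:44:05Z, referee
  abc-iut-rh-ref-2 CONFIRMED 18:48:29Z). [cite: Mochizuki2012, IUTchIV Prop. 1.2 (i) p. 10; IUTchI Def. 3.1 (c),(e) pp. 61–62]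
  [cite: DupuyHilado2025, §3.3, §4.9]
-/

noncomputable section

namespace Summit.ABC.IUTFork.Repair.RH.LinearReachLaw.UnramOdd

open Metric Set Literature.IUT.LogVolume Summit.ABC.IUTFork.Repair.RH.LinearReachLaw
open Literature.AnabelianGeometry.AbsoluteAnabelian Literature.IUT.LogThetaLattice
open scoped Pointwise

/-! ## Integer layer at the unramified datum: e = 1, c = 1, B = 1, D = 0 -/

/-- At `e = c = B = 1` the inflation vanishes: `D = 0`. [folklore] -/
theorem inflation_one_one_one : inflation 1 1 1 = 0 := by unfold inflation; norm_num

-- `not_linearLaw_one_one_one` ((j²−1)·m + 1 ≤ 0 is FALSE for j ≥ 1, m ≥ 0) is abc-iut-rh-typ-1's, in `Repair/RHLinearReachLaw.lean` §4; reused BY NAME below.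

/-- The EXACT companion cell at `e = c = B = 1` follows I06⋆'s pattern on the stratum: TRUE at label `1` (content
`k = m − 2`) … [folklore] -/
theorem reachCell_one_one_one_label_one (m : ℤ) : ReachCell 1 1 1 1 m := by
  refine ⟨m - 2, ?_, ?_⟩ <;> push_cast <;> linarith

/-- … and FALSE at every label `j ≥ 2` of positive depth (`j²·m ≤ m` is absurd): the linear ENVELOPE is strictly
stronger than the exact cell exactly at label 1 (the `< e` slack between the two edges bites when `e = 1`). [folklore] -/
theorem not_reachCell_one_one_one {j : ℕ} (hj : 2 ≤ j) {m : ℤ} (hm : 1 ≤ m) : ¬ ReachCell 1 1 1 j m := by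
  rintro ⟨k, h1, h2⟩
  have hj' : (2 : ℤ) ≤ (j : ℤ) := by exact_mod_cast hj
  have hj2 : (4 : ℤ) ≤ (j : ℤ) ^ 2 := by nlinarith
  have h3 : (4 : ℤ) * m ≤ (j : ℤ) ^ 2 * m := mul_le_mul_of_nonneg_right hj2 (by linarith)
  have h4 : ((j : ℤ) + 1) * (1 + 1 - 1 : ℤ) = (j : ℤ) + 1 := by ring
  rw [h4] at h1
  linarith

/-! ## Semantic layer at an absolutely unramified odd place: `c_w = 1`, `B_w = 1` -/

section Unramified

variable (p : ℕ) [Fact p.Prime]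
variable (K : Type) [NontriviallyNormedField K] [NormedAlgebra ℚ_[p] K] [IsUltrametricDist K] [ProperSpace K]

/-- The lattice of H⋆₂₀ and the carrier of I06⋆ are ONE object: `log_p(𝒪_K^×) = p* · ℐ_K`
(`logShell (ofUnitLog) = (p*)⁻¹ • logUnits`); at `e = 1`, `p` odd both are balls: `Λ = p𝒪`, `ℐ = 𝒪`
(`logShell_ofUnitLog_eq_closedBall_of_unramified`, the set fed to `CandInternal2Real.not_mem_jsq_smul_logShell_of_unramified`).
[cite: Mochizuki2012, IUTchIV Prop. 1.2 (i) p. 10] -/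
theorem lattice_eq_closedBall_of_unramified (hp : 2 < p) (he : absRamificationIdx p K = 1) :
    logUnits K = closedBall (0 : K) ((p : ℝ)⁻¹) := by
  ext z
  rw [mem_logUnits_iff_norm_le_of_unramified p hp he z, mem_closedBall_zero_iff]

/-- … and the real log-shell is the unit ball `ℐ_K = 𝒪_K` (campaign-S `logShell_ofUnitLog_eq_closedBall_of_unramified`).
[cite: Mochizuki2012, IUTchIV Prop. 1.2 (i) p. 10] -/
theorem shell_eq_closedBall_of_unramified (hp : 2 < p) (he : absRamificationIdx p K = 1) :
    logShell (PadicLogOnUnits.ofUnitLog p K) = closedBall (0 : K) 1 :=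
  logShell_ofUnitLog_eq_closedBall_of_unramified p K (by omega) he

/-- **Inner conductor `c_w = 1`** at an absolutely unramified odd place (norm uniformizer `‖ϖ‖ = p⁻¹`): `p𝒪 ⊆ Λ = p𝒪` and `1 ∉ p𝒪`.
[cite: Mochizuki2012, IUTchIV Prop. 1.2 (i) p. 10] -/
theorem isInnerConductor_one (hp : 2 < p) (he : absRamificationIdx p K = 1) {ϖ : Kˣ}
    (hϖ : ‖(ϖ : K)‖ = (p : ℝ)⁻¹) : IsInnerConductor K ϖ 1 := by
  refine ⟨fun z hz => ?_, fun c' hc' => ?_⟩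
  · rw [mem_closedBall_zero_iff, pow_one, hϖ] at hz
    exact (mem_logUnits_iff_norm_le_of_unramified p hp he z).mpr hz
  · by_contra hlt
    have hc0 : c' = 0 := by omega
    subst hc0
    have h1 : (1 : K) ∈ logUnits K := hc' (by rw [mem_closedBall_zero_iff, pow_zero, norm_one])
    rw [mem_logUnits_iff_norm_le_of_unramified p hp he, norm_one] at h1
    have hp1 : (1 : ℝ) < p := by exact_mod_cast lt_trans one_lt_two hp
    have hp0 : (0 : ℝ) < p := by positivity
    have h2 : (p : ℝ) * 1 ≤ (p : ℝ) * (p : ℝ)⁻¹ := mul_le_mul_of_nonneg_left h1 hp0.le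
    rw [mul_inv_cancel₀ hp0.ne', mul_one] at h2
    linarith

/-- **Outer order `B_w = 1`** at an absolutely unramified odd place: `max ‖log_p(𝒪^×)‖ = p⁻¹ = ‖ϖ‖¹`, attained at `ϖ`.
[cite: Mochizuki2012, IUTchIV Prop. 1.2 (i) p. 10] -/
theorem isOuterOrder_one (hp : 2 < p) (he : absRamificationIdx p K = 1) {ϖ : Kˣ}
    (hϖ : ‖(ϖ : K)‖ = (p : ℝ)⁻¹) : IsOuterOrder K ϖ 1 := by
  refine ⟨fun z hz => ?_, ⟨(ϖ : K), ?_, by rw [zpow_one]⟩⟩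
  · rw [zpow_one, hϖ]
    exact (mem_logUnits_iff_norm_le_of_unramified p hp he z).mp hz
  · exact (mem_logUnits_iff_norm_le_of_unramified p hp he _).mpr (by rw [hϖ])

/-- **k2 (unramified-odd refutation family) — H⋆₂₀ FAILS at the family's datum.**  For `K/ℚ_p` absolutely
unramified, `p` odd, `ϖ` a norm uniformizer: `¬ HStarLinearReachLaw p K ϖ j m` at EVERY label `j ≥ 1` and EVERY depth
`m ≥ 0` (witness `c = B = 1`, `D = 0`, law `(j²−1)m + 1 ≤ 0`).  Same engine as
`Repair.CandInternal2Real.not_mem_jsq_smul_logShell_of_unramified` (I06⋆ NEG at `j ≥ 2`); H⋆₂₀ is NEG already at `j = 1`.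
[cite: Mochizuki2012, IUTchIV Prop. 1.2 (i) p. 10] -/
theorem not_hStarLinearReachLaw_of_unramified (hp : 2 < p) (he : absRamificationIdx p K = 1) {ϖ : Kˣ}
    (hϖ : ‖(ϖ : K)‖ = (p : ℝ)⁻¹) {j : ℕ} (hj : 1 ≤ j) {m : ℤ} (hm : 0 ≤ m) :
    ¬ HStarLinearReachLaw p K ϖ j m := by
  intro h
  have hL := h 1 1 (isInnerConductor_one p K hp he hϖ) (isOuterOrder_one p K hp he hϖ)
  rw [he] at hL
  simp only [Nat.cast_one] at hL
  exact Summit.ABC.IUTFork.Repair.RH.LinearReachLaw.not_linearLaw_one_one_one hm hj hL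

/-- The exact companion `HReachCell` is NEG at the same datum for `j ≥ 2`, `m ≥ 1` (I06⋆'s sign there).
[cite: Mochizuki2012, IUTchIV Prop. 1.2 (i) p. 10] -/
theorem not_hReachCell_of_unramified (hp : 2 < p) (he : absRamificationIdx p K = 1) {ϖ : Kˣ}
    (hϖ : ‖(ϖ : K)‖ = (p : ℝ)⁻¹) {j : ℕ} (hj : 2 ≤ j) {m : ℤ} (hm : 1 ≤ m) :
    ¬ HReachCell p K ϖ j m := by
  intro h
  have hL := h 1 1 (isInnerConductor_one p K hp he hϖ) (isOuterOrder_one p K hp he hϖ)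
  rw [he] at hL
  simp only [Nat.cast_one] at hL
  exact not_reachCell_one_one_one hj hm hL

/-- **JUNK-ϖ PROBE (the decl as typed quantifies over an ARBITRARY unit ϖ).**  At a unit of norm `1` the inner
conductor is uninhabited (`1 ∉ log_p(𝒪^×) = p𝒪`), so `HStarLinearReachLaw p K ϖ j m` holds VACUOUSLY at every label
and depth: the truth value at a datum depends on the ϖ-binding, which the datum-level typing must pin
(`‖ϖ‖ = p^{−1/e}` / `IsUniformizer ϖ`). [cite: Mochizuki2012, IUTchIV Prop. 1.2 (i) p. 10] -/
theorem hStarLinearReachLaw_of_norm_eq_one (hp : 2 < p) (he : absRamificationIdx p K = 1) {ϖ : Kˣ}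
    (hϖ : ‖(ϖ : K)‖ = 1) (j : ℕ) (m : ℤ) : HStarLinearReachLaw p K ϖ j m := by
  intro c B hc _
  exfalso
  have h1 : (1 : K) ∈ logUnits K := hc.1 (by rw [mem_closedBall_zero_iff, hϖ, one_pow, norm_one])
  rw [mem_logUnits_iff_norm_le_of_unramified p hp he, norm_one] at h1
  have hp1 : (1 : ℝ) < p := by exact_mod_cast lt_trans one_lt_two hp
  have hp0 : (0 : ℝ) < p := by positivity
  have h2 : (p : ℝ) * 1 ≤ (p : ℝ) * (p : ℝ)⁻¹ := mul_le_mul_of_nonneg_left h1 hp0.le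
  rw [mul_inv_cancel₀ hp0.ne', mul_one] at h2
  linarith

end Unramified

/-! ## The datum of record: `K_w = ℚ_p`, `ϖ = p` (R-W row S-RAT; I06STAR-COLUMNS `concrete:Cor312LicenceSharpRat@p7.j1` POS /
`@p7.j2` NEG by p432650) -/

section Padic

variable (p : ℕ) [Fact p.Prime]

/-- **¬ H⋆₂₀ at `K_w = ℚ_p`, `ϖ = p` (`p` odd), every label `j ≥ 1`, every depth `m ≥ 0`** — the datum of R-W row S-RAT /
I06STAR-COLUMNS `concrete:Cor312LicenceSharpRat@p7.j1` (I06⋆ POS) and `@p7.j2` (I06⋆ NEG, p432650).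
[cite: Mochizuki2012, IUTchIV Prop. 1.2 (i) p. 10] -/
theorem not_hStarLinearReachLaw_padic (hp : 2 < p) {j : ℕ} (hj : 1 ≤ j) {m : ℤ} (hm : 0 ≤ m) :
    ¬ HStarLinearReachLaw p ℚ_[p] (Units.mk0 (p : ℚ_[p]) (Nat.cast_ne_zero.2 (Fact.out : p.Prime).ne_zero)) j m :=
  not_hStarLinearReachLaw_of_unramified p ℚ_[p] hp (absRamificationIdx_padic p)
    (by rw [Units.val_mk0, Padic.norm_p]) hj hm

/-- Cell S-RAT@p7.j1 (I06⋆ POS there): H⋆₂₀ NEG at every depth `m ≥ 0`. [folklore] -/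
example [Fact (Nat.Prime 7)] (m : ℤ) (hm : 0 ≤ m) :
    ¬ HStarLinearReachLaw 7 ℚ_[7] (Units.mk0 ((7 : ℕ) : ℚ_[7]) (Nat.cast_ne_zero.2 (by norm_num))) 1 m :=
  not_hStarLinearReachLaw_padic 7 (by norm_num) le_rfl hm

/-- Cell S-RAT@p7.j2 (I06⋆ NEG there by `CandInternal2Real.not_mem_jsq_smul_logShell_of_unramified`): H⋆₂₀ NEG. [folklore] -/
example [Fact (Nat.Prime 7)] (m : ℤ) (hm : 0 ≤ m) :
    ¬ HStarLinearReachLaw 7 ℚ_[7] (Units.mk0 ((7 : ℕ) : ℚ_[7]) (Nat.cast_ne_zero.2 (by norm_num))) 2 m :=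
  not_hStarLinearReachLaw_padic 7 (by norm_num) (by norm_num) hm

/-- … while at the junk binding `ϖ = 1 ∈ ℚ_7ˣ` the same decl is (vacuously) TRUE at the same cells. [folklore] -/
example [Fact (Nat.Prime 7)] (j : ℕ) (m : ℤ) : HStarLinearReachLaw 7 ℚ_[7] 1 j m :=
  hStarLinearReachLaw_of_norm_eq_one 7 ℚ_[7] (by norm_num) (absRamificationIdx_padic 7) (by simp) j m

/-- I06⋆'s own kill at the datum, for the record (family member p432650). [cite: Mochizuki2012, IUTchIV Prop. 1.2 (i) p. 10] -/
example [Fact (Nat.Prime 7)] :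
    ((7 : ℕ) : ℚ_[7]) ∉ ((7 : ℕ) : ℚ_[7]) ^ (2 ^ 2) • logShell (PadicLogOnUnits.ofUnitLog 7 ℚ_[7]) :=
  Summit.ABC.IUTFork.Repair.CandInternal2Real.not_mem_jsq_smul_logShell_of_unramified 7 ℚ_[7] (by norm_num)
    (absRamificationIdx_padic 7) (by exact_mod_cast (show (7 : ℕ) ≠ 0 by norm_num))
    (by rw [Padic.norm_p]; norm_num) le_rfl

end Padic

/-! ## §3. Datum level: the DECIDING declaration `RH.LinearReachLaw.CellAt` / `HStar` (abc-iut-rh-typ-7, p464190) at an unramified odd place -/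

section Datum

open Summit.ABC.IUTFork.Thm311 Summit.ABC.IUTFork.Thm311.Real Summit.ABC.IUTFork.Cor312 Summit.ABC.IUTFork.Cor312Prov

variable {F : Type} [Field F] [NumberField F] (X : PilotData F)

/-- The `2l`-cleared law at `e = c = B = 1` reads `(j² − 1)·ord(q) + 2l ≤ 0`: FALSE for `j ≥ 1`, `ord(q) ≥ 0`, `l ≥ 1`. [folklore] -/
theorem not_linearLaw2l_one_one_one {j l : ℕ} (hl : 0 < l) (hj : 1 ≤ j) {ordq : ℤ} (hq : 0 ≤ ordq) :
    ¬ LinearLaw2l 1 1 1 j ordq l := by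
  unfold LinearLaw2l inflation
  intro h
  have hj' : (1 : ℤ) ≤ (j : ℤ) := by exact_mod_cast hj
  have hl' : (0 : ℤ) < (l : ℤ) := by exact_mod_cast hl
  have h1 : (0 : ℤ) ≤ ((j : ℤ) ^ 2 - 1) * ordq := mul_nonneg (by nlinarith) hq
  have h2 : (2 : ℤ) * l * (((j : ℤ) + 1) * ((1 - 1) + (1 - 1))) = 0 := by ring
  linarith

/-- **H⋆₂₀'s deciding CELL fails at every place `x | p` of a pilot datum with `e(x|p) = 1`, `p` odd and `ord_x(q) ≥ 0`, at EVERY label**: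
abc-iut-rh-typ-7's column certificate `not_cellAt_of_not_col` at the turning point `a₀ = 0` (`c = ⌊1/(p−1)⌋ + 1 = 1`, `B = p⁰ − 0 = 1`,
law `((i+1)² − 1)·ord_x(q) + 2l ≤ 0`). [cite: Mochizuki2012, IUTchIV Prop. 1.2 (i) p. 10] -/
theorem not_cellAt_of_unramified_odd (pp : Nat.Primes) [Fact (pp : ℕ).Prime] (i : Fin X.lstar) (x : (thetaIndex X).Fibre (.inr pp))
    (hp : 2 < (pp : ℕ)) (he : (placeOf X pp.1 x).asIdeal.ramificationIdx ℤ = 1) (hq : 0 ≤ X.ordq (placeOf X pp.1 x)) :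
    ¬ CellAt X pp i x := by
  have hl : 0 < X.l := by have := X.five_le_l; omega
  refine not_cellAt_of_not_col X pp i x (a₀ := 0) (fun a ha => absurd ha (Nat.not_lt_zero a)) ?_ ?_
  · rw [he]
    simp only [Nat.cast_one, pow_zero, one_mul]
    have h2 := (Fact.out : (pp : ℕ).Prime).two_le
    omega
  · rw [he]
    have hc : (1 / ((pp : ℕ) - 1) + 1 : ℕ) = 1 := by rw [Nat.div_eq_of_lt (by omega)]
    rw [hc]
    simpa using not_linearLaw2l_one_one_one hl (Nat.succ_le_succ (Nat.zero_le _)) hq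

/-- **¬ H⋆₂₀ — the deciding declaration `RH.LinearReachLaw.HStar X` (p464190) FAILS at every pilot datum `X` having an absolutely
unramified odd BAD place** (`ord_x(q) > 0` there, `PilotData.ordq_pos`). READING: «H⋆₂₀ ⟹ S_H» is VACUOUS at such data — the
unramified-odd family cannot kill a sufficient-side row, and H⋆₂₀ rescues nothing there (consistent with RP-I06⋆ NEG at such places,
p432650, and with `S_H` refuted there, R-W row S-RAT). Scope at the genuine `K`-level datum: §4. [cite: Mochizuki2012, IUTchIV Prop. 1.2 (i) p. 10] -/
theorem not_hStar_of_unramified_odd_badPlace (pp : Nat.Primes) [Fact (pp : ℕ).Prime] (x : (thetaIndex X).Fibre (.inr pp))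
    (hx : placeOf X pp.1 x ∈ X.S) (hp : 2 < (pp : ℕ)) (he : (placeOf X pp.1 x).asIdeal.ramificationIdx ℤ = 1) : ¬ HStar X :=
  not_hStar_of_not_cellAt X pp ⟨0, by have := X.two_le_lstar; omega⟩ x hx
    (not_cellAt_of_unramified_odd X pp _ x hp he (X.ordq_pos hx).le)

end Datum

/-! ## §4. Scope (v1's §3): the stratum carries no bad place of the genuine `K`-level datum -/

section Genuine

open Summit.ABC.IUTFork.Cor312 Summit.ABC.IUTFork.Cor312Prov Summit.ABC.IUTFork.Thm311 Summit.ABC.IUTFork.Thm311.Real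
open Literature.IUT.HodgeTheaters NumberField

variable {F K Fbar : Type} [Field F] [NumberField F] [Field K] [NumberField K] [Algebra F K] [Field Fbar]
  [Algebra F Fbar] [Algebra K Fbar] {E : WeierstrassCurve F} [E.IsElliptic] {l : ℕ} {Pb : BadPlacePredicates K}
  (D : InitialThetaData F K Fbar E l Pb)

/-- **No instance of the unramified-odd family at a genuine bad place.** At every bad place `x₀ | p` of print's `K`-level pilot
datum `pilotDataOfK D K` the completion has `e ≥ l ≥ 5`, so the hypothesis `absRamificationIdx p K_{x₀} = 1` of §2 never fires
(`Cor312Prov.l_le_absRamificationIdx_kOf_pilotDataOfK`; = `RHLabelCutJ3K2.absRamificationIdx_ne_one_pilotDataOfK`, restated for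
row 20's record). [cite: Mochizuki2012, IUTchI Def. 3.1 (c),(e) pp. 61–62] -/
theorem no_unramified_instance_at_genuine_badPlace (pp : Nat.Primes) [Fact (pp : ℕ).Prime]
    (x₀ : (thetaIndex (pilotDataOfK D K)).Fibre (.inr pp)) (hx : placeOf (pilotDataOfK D K) pp.1 x₀ ∈ (pilotDataOfK D K).S) :
    ¬ absRamificationIdx (pp : ℕ) (kOf (pilotDataOfK D K) pp.1 x₀) = 1 :=
  Summit.ABC.IUTFork.Repair.RHLabelCutJ3K2.absRamificationIdx_ne_one_pilotDataOfK D pp x₀ hx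


/-- **No instance of the unramified-odd family at a genuine bad place — in §3's currency `e(x₀|p)`.** At every bad place `x₀ | p` of print's `K`-level pilot
datum `pilotDataOfK D K` one has `e(x₀|p) ≥ l ≥ 5`, so §3's hypothesis `he : e(x₀|p) = 1` never fires there
(`Cor312Prov.l_le_absRamificationIdx_kOf_pilotDataOfK`, `RHLabelCutJ3K2.absRamificationIdx_ne_one_pilotDataOfK`,
`RH.ShellCapacityPlus.absRamificationIdx_kOf`; restated in §3's currency for row 20's record). [cite: Mochizuki2012, IUTchI Def. 3.1 (c),(e) pp. 61–62] -/
theorem ramificationIdx_ne_one_at_genuine_badPlace (pp : Nat.Primes) [Fact (pp : ℕ).Prime]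
    (x₀ : (thetaIndex (pilotDataOfK D K)).Fibre (.inr pp)) (hx : placeOf (pilotDataOfK D K) pp.1 x₀ ∈ (pilotDataOfK D K).S) :
    (placeOf (pilotDataOfK D K) pp.1 x₀).asIdeal.ramificationIdx ℤ ≠ 1 := by
  rw [← Summit.ABC.IUTFork.Repair.RH.ShellCapacityPlus.absRamificationIdx_kOf (pilotDataOfK D K) pp x₀]
  exact Summit.ABC.IUTFork.Repair.RHLabelCutJ3K2.absRamificationIdx_ne_one_pilotDataOfK D pp x₀ hx

end Genuine

end Summit.ABC.IUTFork.Repair.RH.LinearReachLaw.UnramOdd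

end
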